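import Summits.Parity.GeneralizedHardyLittlewood.Theses.OneSidedAggregateExchangeRate
import Literature.Barriers.Parity.FordMaynardPrimeSieves
import HarnessLib

/-!
# BC3 birth skeleton — crux `OneSidedSiftedComparison` (K2, rank 3) of route `OneSidedAggregateExchangeRate`
(Parity / GeneralizedHardyLittlewood; item stmt-Parity-18974)

Line-writer seat `linewriter-parity-certcluster-1` g0, 2026-08-31 (re-authored from the route header's TWO-LAYER PLAN
"K2 OneSidedSiftedComparison ⇐ S_c TypeIIBottom → S_d (TII(1/7) → E1[1/7] two-sided, comparison principle + BV) → K2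
[specialisation to g_s proved]" and the sketch SKETCH.md §K2; the pre-open birth `bc/OneSidedSiftedComparison_birth.lean`
sha16 a82c4729… lives gate-side only).

LINE (TypeIIBottom).  K2 = `E1⁻_g[1/7]`: for `δ ∈ (0,1/7)`, `θ > 0` and large `x`,
`Σ_{d ∈ D_x(1/7,δ)} g_s(d)·(S(a;d) − S(b;d)) ≥ −θ·x/log x` (ONE explicit linear statistic of the twin indicator against its
`z`-sifted model, lower inequality only).

* `stub_typeIIBottom` (S_c, IDEA-NEEDED — the open content): TII(1/7), Type-II information for the pair `(a, b)` with the SHORT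
  variable in the bottom window `(x^{δ'}, (2x)^{1/7}]`, arbitrary divisor-bounded coefficients, every log-power — typed in the tree's
  Ford–Maynard axiom format `Literature.Barriers.Parity.FordMaynard.TypeII w X θ ν B` with `w = a − b`, height `X = 2x` (window
  `x < mn ≤ 2x`), `θ = δ'`, `ν = 1/7 − δ'`.  Certified PARITY-BLIND: with `ν = 1/7 < 0.1616` even TII + BV + positivity produce no
  primes (FM Thm 2.7(c) [arXiv:2407.14368 p. 7]; tree `Literature.Barriers.Parity.FordMaynard.PrimeFreeAdmissible`), so S_c is not the
  twin prime conjecture in disguise; it is the unbalanced corner `m ≤ x^{1/7}` of Harman's missing Type II for `p + 2`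
  [Harman2007 p. 286], after Cauchy = HL for pairs `(mn+2, m'n+2)` over `≍ x^{2/7}` pairs of length `x^{6/7}` (no variance trick).
* `stub_comparisonPrinciple` (S_d, THEOREM-GRADE, L–XL): TII(1/7) ⇒ `E1[1/7]` two-sided — for all `1`-bounded `c_d` on `D_x(1/7,δ)`,
  `|Σ_d c_d (S(a;d) − S(b;d))| ≤ θ·x/log x` eventually.  Harman's comparison principle ([SME] Prop 3.1; Harman, *Prime-Detecting
  Sieves* Thm 3.1 shape): expand the `x^{1/7}`-roughness of `n/d` by Möbius over `e ∣ P(x^{1/7})`; `de ≤ x^{1/2−δ/2}` is Type I —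
  Bombieri–Vinogradov for `a` (tree `Literature.NumberTheory.Sieve.bombieri_vinogradov_holds`) and the fundamental lemma for the
  `z`-sifted model `b`, whose local densities match those of `a` up to `Π_{p ∣ q, p ≥ z}(1 − 1/p) = 1 + O(ω(q)/z)`,
  `z = exp((log log x)²)` beating every log-power; `de > x^{1/2−δ/2}` forces `e > x^{δ/2}`, and an `x^{1/7}`-smooth `e > x^{δ'}`
  (`δ' = min(δ/2, 1/14)`) has a divisor in `(x^{δ'}, x^{1/7}]` (largest prime if `> x^{δ'}`, else a greedy partial product in
  `(x^{δ'}, x^{2δ'}]`) — Type II with divisor-bounded coefficients after removing cross-conditions (Perron), `O((log x)^C)` forms.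
* Composition (PROVED below): `|g_s| ≤ 5` (`abs_gW_le`), so `c = g_s/5` is admissible in `E1[1/7]` at `θ/5`.

Honesty (BC3): S_c is STRICTLY STRONGER than K2 only through the theorem-grade S_d (two-sided, all coefficients, log-power precision
vs. one weight, one side, `o(x/log x)`) — the strengthening the route header itself names ("TII(1/7) ⇒ E1[1/7] ⇒ E1⁻_g[1/7]"); it
does not restate K2 (a bilinear-form axiom, no sifted sums, no weight `g_s`) and does not reach the summit (certified inert window).
S_d is an implication with K2-free content (it holds for every pair `(a,b)` with matching Type-I densities).
-/

noncomputable section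

namespace Summit.Parity.GeneralizedHardyLittlewood.Cruxes.OneSidedSiftedComparison.Birth

open scoped BigOperators Classical
open Literature.NumberTheory.Sieve
open Summit.Parity.GeneralizedHardyLittlewood.Theses.OneSidedAggregateExchangeRate

/-! ## Vocabulary — verbatim the `let`s of `OneSidedSiftedComparison` (K2), as functions of `x` (and `δ`) -/

/-- `z = exp((log log x)²)`. -/
def zW (x : ℕ) : ℝ := Real.exp (Real.log (Real.log (x : ℝ)) ^ 2)
/-- `V = ∏_{p<z} (1 − 1/p)`. -/
def VW (x : ℕ) : ℝ := ∏ p ∈ (Finset.range ⌈zW x⌉₊).filter Nat.Prime, (1 - 1 / (p : ℝ))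
/-- `a(n) = log(n+2)·1_{n+2 prime}` (the twin host). -/
def aW : ℕ → ℝ := fun n => if (n + 2).Prime then Real.log ((n : ℝ) + 2) else 0
/-- `b(n) = 1_{n+2 is z-rough}/V` (the sieve model of `a`). -/
def bW (x : ℕ) : ℕ → ℝ := fun n => if ∀ p ∈ (n + 2).primeFactors, zW x ≤ (p : ℝ) then 1 / VW x else 0
/-- `y = x^{1/7}`. -/
def yW (x : ℕ) : ℝ := (x : ℝ) ^ ((1 : ℝ) / 7)
/-- `S(c; d) = Σ_{x<n≤2x, d∣n, n/d y-rough} c(n)`. -/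
def SW (x : ℕ) : (ℕ → ℝ) → ℕ → ℝ := fun c d =>
  ∑ n ∈ (Finset.Ioc x (2 * x)).filter (fun n : ℕ => d ∣ n ∧ ∀ p ∈ (n / d).primeFactors, yW x ≤ (p : ℝ)), c n
/-- `idx p = ⌊140 log p/log x⌋ − 20`. -/
def idxW (x : ℕ) : ℕ → ℕ := fun p => ⌊140 * Real.log (p : ℝ) / Real.log (x : ℝ)⌋₊ - 20
/-- the certified three-prime-cell pattern of `g_s` (values −1/−2/−5). -/
def g₃W : ℕ → ℕ → ℕ → ℝ := fun i j k =>
  if i = 0 ∧ j = 0 ∧ k = 0 then -1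
  else if (i = 0 ∧ j = 0) ∨ (i = 0 ∧ j = 1 ∧ 2 ≤ k) ∨ (i = 0 ∧ j = 2 ∧ 5 ≤ k) ∨ (i = 1 ∧ j = 1 ∧ 5 ≤ k) then -2 else -5
/-- the step weight `g = g_s`. -/
def gW (x : ℕ) : ℕ → ℝ := fun d =>
  if d.primeFactors.card = 0 then 1 else if d.primeFactors.card = 1 then -1 else if d.primeFactors.card = 2 then 1
  else if d.primeFactors.card = 3 then
    g₃W (idxW x d.minFac) ((∑ p ∈ d.primeFactors, idxW x p) - idxW x d.minFac - idxW x (d.primeFactors.sup id))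
      (idxW x (d.primeFactors.sup id))
  else 0
/-- `D = D_x(1/7, δ)`: squarefree `y`-rough `d ≤ x^{1/2−δ}`. -/
def DW (x : ℕ) (δ : ℝ) : Finset ℕ :=
  (Finset.Icc 1 ⌊(x : ℝ) ^ ((1 : ℝ) / 2 - δ)⌋₊).filter (fun d : ℕ => Squarefree d ∧ ∀ p ∈ d.primeFactors, yW x ≤ (p : ℝ))

/-- K2 unfolded over the vocabulary (PROVED, definitional). -/
theorem oneSidedSiftedComparison_iff :
    OneSidedSiftedComparison ↔
      ∀ δ : ℝ, 0 < δ → δ < 1 / 7 → ∀ θ : ℝ, 0 < θ → ∃ x₀ : ℕ, ∀ x : ℕ, x₀ ≤ x →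
        -θ * (x : ℝ) / Real.log (x : ℝ) ≤ ∑ d ∈ DW x δ, gW x d * (SW x aW d - SW x (bW x) d) :=
  Iff.rfl

/-- `|g₃| ≤ 5` (PROVED). -/
theorem abs_g₃W_le (i j k : ℕ) : |g₃W i j k| ≤ 5 := by
  simp only [g₃W]
  split_ifs <;> norm_num

/-- `|g_s| ≤ 5` (PROVED; the weight takes the values `1, −1, 1, −1, −2, −5, 0`). -/
theorem abs_gW_le (x d : ℕ) : |gW x d| ≤ 5 := by
  simp only [gW]
  split_ifs <;> first | exact abs_g₃W_le _ _ _ | norm_num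

/-- `E1[1/7]` two-sided: every `1`-bounded linear statistic of the sifted sums of `a` against those of `b` over `D_x(1/7,δ)`
is `o(x/log x)`, uniformly in the coefficients. -/
def E1TwoSided : Prop :=
  ∀ δ : ℝ, 0 < δ → δ < 1 / 7 → ∀ θ : ℝ, 0 < θ → ∃ x₀ : ℕ, ∀ x : ℕ, x₀ ≤ x → ∀ c : ℕ → ℝ, (∀ d, |c d| ≤ 1) →
    |∑ d ∈ DW x δ, c d * (SW x aW d - SW x (bW x) d)| ≤ θ * (x : ℝ) / Real.log (x : ℝ)

/-! ## The two stubs (statements spelled out; `Signature.*` are the same terms by `rfl`, see the `example`s) -/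

/-- S_c signature: TII(1/7) in Ford–Maynard format for `w = a − b` at height `2x`. -/
def Signature.stub_typeIIBottom : Prop :=
  ∀ δ' : ℝ, 0 < δ' → δ' < 1 / 7 → ∀ B : ℝ, 0 < B → ∃ x₀ : ℕ, ∀ x : ℕ, x₀ ≤ x →
    Literature.Barriers.Parity.FordMaynard.TypeII (fun n => aW n - bW x n) (2 * (x : ℝ)) δ' (1 / 7 - δ') B

/-- **S_c `stub_typeIIBottom`** (IDEA-NEEDED): TII(1/7) — for every `δ' ∈ (0, 1/7)`, `B > 0` and large `x`, all bilinear forms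
`Σ_{x^{δ'} < m ≤ (2x)^{1/7}} Σ_{x < mn ≤ 2x} ξ_m κ_n (a(mn) − b(mn))` with `|ξ_m| ≤ τ(m)^B`, `|κ_n| ≤ τ(n)^B` are
`≤ 2x/(log 2x)^B` (`Literature.Barriers.Parity.FordMaynard.TypeII`, [arXiv:2407.14368 §1 (II)]). -/
theorem stub_typeIIBottom :
    ∀ δ' : ℝ, 0 < δ' → δ' < 1 / 7 → ∀ B : ℝ, 0 < B → ∃ x₀ : ℕ, ∀ x : ℕ, x₀ ≤ x →
      Literature.Barriers.Parity.FordMaynard.TypeII (fun n => aW n - bW x n) (2 * (x : ℝ)) δ' (1 / 7 - δ') B := by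
  sorry

example : Signature.stub_typeIIBottom := stub_typeIIBottom

/-- S_d signature: the comparison principle. -/
def Signature.stub_comparisonPrinciple : Prop :=
  Signature.stub_typeIIBottom → E1TwoSided

/-- **S_d `stub_comparisonPrinciple`** (theorem-grade, L–XL): TII(1/7) ⇒ `E1[1/7]` two-sided (Harman's comparison principle with
Bombieri–Vinogradov Type I for `a` and the fundamental lemma for the `z`-sifted model `b`; see the module docstring). -/
theorem stub_comparisonPrinciple : Signature.stub_typeIIBottom → E1TwoSided := by
  sorry

example : Signature.stub_comparisonPrinciple := stub_comparisonPrinciple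

/-! ## Composition (kernel-checked) -/

/-- **K2 from the two stubs** (PROVED): apply `E1[1/7]` at `θ/5` to the admissible coefficients `c = g_s/5`. -/
theorem OneSidedSiftedComparison_of :
    Signature.stub_typeIIBottom → Signature.stub_comparisonPrinciple → OneSidedSiftedComparison := by
  intro hT hC
  have hE : E1TwoSided := hC hT
  rw [oneSidedSiftedComparison_iff]
  intro δ hδ hδ' θ hθ
  obtain ⟨x₀, hx₀⟩ := hE δ hδ hδ' (θ / 5) (by positivity)
  refine ⟨x₀, fun x hx => ?_⟩
  have hc : ∀ d, |gW x d / 5| ≤ 1 := fun d => by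
    rw [abs_div, abs_of_pos (by norm_num : (0 : ℝ) < 5), div_le_one (by norm_num : (0 : ℝ) < 5)]
    exact abs_gW_le x d
  have h := (abs_le.mp (hx₀ x hx (fun d => gW x d / 5) hc)).1
  have hsum : ∑ d ∈ DW x δ, gW x d / 5 * (SW x aW d - SW x (bW x) d) =
      (∑ d ∈ DW x δ, gW x d * (SW x aW d - SW x (bW x) d)) / 5 := by
    rw [Finset.sum_div]
    exact Finset.sum_congr rfl fun d _ => by ring
  rw [hsum] at h
  have key : -θ * (x : ℝ) / Real.log (x : ℝ) = -(θ / 5 * (x : ℝ) / Real.log (x : ℝ)) * 5 := by ring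
  calc -θ * (x : ℝ) / Real.log (x : ℝ) = -(θ / 5 * (x : ℝ) / Real.log (x : ℝ)) * 5 := key
    _ ≤ (∑ d ∈ DW x δ, gW x d * (SW x aW d - SW x (bW x) d)) / 5 * 5 :=
        mul_le_mul_of_nonneg_right h (by norm_num)
    _ = ∑ d ∈ DW x δ, gW x d * (SW x aW d - SW x (bW x) d) := by ring

/-- **The skeleton instantiated**: K2 BY NAME modulo the two registered stubs (carries exactly their `sorry`s). -/
theorem OneSidedSiftedComparison_of_stubs : OneSidedSiftedComparison :=
  OneSidedSiftedComparison_of stub_typeIIBottom stub_comparisonPrinciple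

end Summit.Parity.GeneralizedHardyLittlewood.Cruxes.OneSidedSiftedComparison.Birth

end
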